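import Mathlib
import Summits.Ventures.PercRepro2.SwOutCrossBaseEdges
import Summits.Ventures.PercRepro2.SwOutCrossGenFarM

/-!
# The cross base, for ANY cross graph: the red edge set of the realisation (blind cell PercRepro2,
night-4 g25, 2026-08-28; proofs/NIGHT4-G25.md §3)

`SwOutCrossBaseEdges` §RedEdges re-stated on the minimal record `fibKEEMin G` of the edge-atom
fibre (the same data fields, no connectivity): `redEdges_crossRealM` — at a point without
red-side leak the red edges of the red cluster of `h` in the realisation are `φX` of the red atoms
`ERFM (fibKEEMin G)` of the point.  The proof is the landed one verbatim; `G` is any cross graph.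
-/

namespace Summit.Ventures.PercRepro2

namespace CrossArm

open Hull LocRows

variable {V E : Type*}

open scoped Classical

section RedEdges

variable {ends : E → Sym2 V} {σ : Config E} {h u : V} {ι X κ : Type*} {U : ι → Set V}
  {p : X → V} {G : SimpleGraph X} {F : κ → Set V} [Fintype X] [DecidableEq X]
  [DecidableRel G.Adj] [Nonempty X] (hb : CrossBase ends σ h u U p G F)

omit [Fintype X] [DecidableEq X] [DecidableRel G.Adj] [Nonempty X] in
/-- A fibre atom is red in the generic cube iff some u-arm is red and the atom is red. -/
lemma mem_ERFM_inl {q : PtXG ι κ X G} {a : AtomKEE X G} :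
    Sum.inl (Sum.inr (Sum.inr a)) ∈ ERFM (fibKEEMin G) (toGen G q) ↔
      redUG q.2.1 ∧ redKEE G q.2.2 a = true := by
  simp only [ERFM, Set.mem_union, Set.mem_image]
  constructor
  · rintro (⟨b, hb', hab⟩ | h')
    · rw [Sum.inl.injEq] at hab
      subst hab
      exact hb'
    · exact h'.elim
  · intro h'
    exact Or.inl ⟨_, h', rfl⟩

omit [Fintype X] [DecidableEq X] [DecidableRel G.Adj] [Nonempty X] in
/-- A u-arm atom is red in the generic cube iff the arm is red. -/
lemma mem_ERFM_arm {q : PtXG ι κ X G} {j : ι} :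
    Sum.inl (Sum.inl j) ∈ ERFM (fibKEEMin G) (toGen G q) ↔ q.2.1 j = true := by
  simp only [ERFM, Set.mem_union, Set.mem_image]
  constructor
  · rintro (⟨b, hb', hab⟩ | h')
    · rw [Sum.inl.injEq] at hab
      subst hab
      exact hb'
    · exact h'.elim
  · intro h'
    exact Or.inl ⟨_, h', rfl⟩

omit [Fintype X] [DecidableEq X] [DecidableRel G.Adj] [Nonempty X] in
/-- The atom `u` is red in the generic cube iff some u-arm is red. -/
lemma mem_ERFM_u {q : PtXG ι κ X G} :
    Sum.inl (Sum.inr (Sum.inl ())) ∈ ERFM (fibKEEMin G) (toGen G q) ↔ redUG q.2.1 := by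
  simp only [ERFM, Set.mem_union, Set.mem_image]
  constructor
  · rintro (⟨b, hb', hab⟩ | h')
    · rw [Sum.inl.injEq] at hab
      subst hab
      exact hb'
    · exact h'.elim
  · intro h'
    exact Or.inl ⟨_, h', rfl⟩

omit [Fintype X] [DecidableEq X] [DecidableRel G.Adj] [Nonempty X] in
/-- A far-arm atom is red in the generic cube iff the far arm is red. -/
lemma mem_ERFM_far {q : PtXG ι κ X G} {k : κ} :
    Sum.inr k ∈ ERFM (fibKEEMin G) (toGen G q) ↔ q.1 k = true := by
  simp only [ERFM, Set.mem_union, Set.mem_image]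
  constructor
  · rintro (⟨b, -, hab⟩ | h')
    · exact absurd hab (Sum.inl_ne_inr)
    · exact h'
  · intro h'
    exact Or.inr h'

include hb

omit [Fintype X] [DecidableEq X] [DecidableRel G.Adj] [Nonempty X] in
/-- **The red edge-set form of the hull formula**: at a point without red-side leak, the red edges
of the red cluster of `h` are `φX` of the red atoms (edge atoms) of the point. -/
theorem CrossBase.redEdges_crossRealM (hup : ∀ i, ∃ e, ends e = s(u, p i))
    (hcross : ∀ i j, G.Adj i j → ∃ e, ends e = s(p i, p j)) {q : PtXG ι κ X G}
    (hq : ¬ LeakRX G q) :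
    redEdges ends (crossReal ends u U p G F σ q) h =
      φX ends σ h u U p G F (ERFM (fibKEEMin G) (toGen G q)) := by
  ext e
  rw [mem_redEdges, hb.cluster_crossReal hup hcross hq, mem_φX]
  constructor
  · rintro ⟨hred, x, hx, y, hy, hxy⟩
    rw [mem_redSetX_iff] at hx
    rcases hx with rfl | ⟨j, hj, hx⟩ | ⟨hxu, hs⟩ | ⟨i, rfl, hs, hatt⟩ | ⟨k, hk, hx⟩
    · -- `x = h`: the edge goes into a u-arm or a far arm
      rcases hb.h_edges e y hxy with ⟨j, hy'⟩ | ⟨k, hy'⟩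
      · have hj : q.2.1 j = true := (mem_redSetX_U hb hy').1 hy
        refine ⟨Sum.inl (Sum.inl j), mem_ERFM_arm.2 hj, ?_⟩
        refine ⟨?_, x, Or.inr (Or.inl rfl), y, Or.inl hy', hxy⟩
        rwa [hb.crossReal_apply_U ⟨y, hy', x, ends_swap hxy⟩, if_pos hj] at hred
      · have hk : q.1 k = true := (mem_redSetX_F hb hy').1 hy
        refine ⟨Sum.inr k, mem_ERFM_far.2 hk, ?_⟩
        refine ⟨?_, x, Or.inr rfl, y, Or.inl hy', hxy⟩
        rwa [hb.crossReal_apply_F ⟨y, hy', x, ends_swap hxy⟩, if_pos hk] at hred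
    · -- `x ∈ U j`, red
      have hσ : σ e = true := by
        rwa [hb.crossReal_apply_U ⟨x, hx, y, hxy⟩, if_pos hj] at hred
      refine ⟨Sum.inl (Sum.inl j), mem_ERFM_arm.2 hj, ?_⟩
      refine ⟨hσ, x, Or.inl hx, y, ?_, hxy⟩
      rw [mem_redSetX_iff] at hy
      rcases hy with rfl | ⟨j', -, hy⟩ | ⟨rfl, -⟩ | ⟨i, rfl, -, -⟩ | ⟨k, -, hy⟩
      · exact Or.inr (Or.inl rfl)
      · by_cases hjj : j = j'
        · subst hjj
          exact Or.inl hy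
        · exact absurd hy (fun hy => hb.no_cross_UU j j' hjj e x y hxy hx hy)
      · exact Or.inr (Or.inr rfl)
      · exact absurd hx (hb.no_pU (ends_swap hxy) j)
      · exact absurd hy (fun hy => hb.no_cross_UF j k e x y hxy hx hy)
    · -- `x = u`: the edge goes into a u-arm or to a dropped vertex
      rw [hxu] at hxy
      rcases hb.u_edges e y hxy with ⟨j, hy'⟩ | ⟨i, rfl⟩
      · have hj : q.2.1 j = true := (mem_redSetX_U hb hy').1 hy
        refine ⟨Sum.inl (Sum.inl j), mem_ERFM_arm.2 hj, ?_⟩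
        refine ⟨?_, u, Or.inr (Or.inr rfl), y, Or.inl hy', hxy⟩
        rwa [hb.crossReal_apply_U ⟨y, hy', u, ends_swap hxy⟩, if_pos hj] at hred
      · have huP : q.2.2.1 i = true := by
          rw [hb.crossReal_apply_UP (show e ∈ clsUPX ends u p i from hxy)] at hred
          by_contra hc
          rw [if_neg hc, hb.u_red e (p i) hxy] at hred
          exact absurd hred (by decide)
        refine ⟨Sum.inl (Sum.inr (Sum.inr (Sum.inl i))), mem_ERFM_inl.2 ⟨hs, huP⟩, ?_⟩
        exact hxy
    · -- `x = p i` attached: the edge goes to `u`, along a cross edge, or outside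
      rcases hb.p_edges i e y hxy with hyu | ⟨j, rfl, hadj⟩ | ⟨hyh, hyu, hyp, hyA⟩
      · rw [hyu] at hxy
        have huP : q.2.2.1 i = true := by
          rw [hb.crossReal_apply_UP (show e ∈ clsUPX ends u p i from ends_swap hxy)] at hred
          by_contra hc
          rw [if_neg hc, hb.u_red e (p i) (ends_swap hxy)] at hred
          exact absurd hred (by decide)
        refine ⟨Sum.inl (Sum.inr (Sum.inr (Sum.inl i))), mem_ERFM_inl.2 ⟨hs, huP⟩, ?_⟩
        exact ends_swap hxy
      · have ht : e ∈ clsCX ends p G ⟨s(i, j), G.mem_edgeSet.2 hadj⟩ := ⟨i, j, rfl, hxy⟩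
        have hc : q.2.2.2.1 ⟨s(i, j), G.mem_edgeSet.2 hadj⟩ = true := by
          rw [hb.crossReal_apply_C ht] at hred
          by_contra hc
          rw [if_neg hc, hb.cross_red i j e hxy] at hred
          exact absurd hred (by decide)
        refine ⟨Sum.inl (Sum.inr (Sum.inr (Sum.inr ⟨s(i, j), G.mem_edgeSet.2 hadj⟩))),
          mem_ERFM_inl.2 ⟨hs, ?_⟩, ht⟩
        simp only [redKEE, decide_eq_true_eq]
        exact ⟨hc, i, Sym2.mem_mk_left _ _, hatt⟩
      · exact absurd hy (not_mem_redSetX_of_out hyh hyu hyp hyA)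
    · -- `x ∈ F k`, red
      have hσ : σ e = true := by
        rwa [hb.crossReal_apply_F ⟨x, hx, y, hxy⟩, if_pos hk] at hred
      refine ⟨Sum.inr k, mem_ERFM_far.2 hk, ?_⟩
      refine ⟨hσ, x, Or.inl hx, y, ?_, hxy⟩
      rw [mem_redSetX_iff] at hy
      rcases hy with rfl | ⟨j, -, hy⟩ | ⟨rfl, -⟩ | ⟨i, rfl, -, -⟩ | ⟨k', -, hy⟩
      · exact Or.inr rfl
      · exact absurd hx (fun hx => hb.no_cross_UF j k e y x (ends_swap hxy) hy hx)
      · exact absurd hx (hb.no_uF (ends_swap hxy) k)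
      · exact absurd hx (hb.no_pF (ends_swap hxy) k)
      · by_cases hkk : k = k'
        · subst hkk
          exact Or.inl hy
        · exact absurd hy (fun hy => hb.no_cross_FF k k' hkk e x y hxy hx hy)
  · rintro ⟨α, hα, he⟩
    rcases α with (j | ⟨⟨⟩⟩ | i | t) | k
    · -- a red u-arm
      have hj : q.2.1 j = true := mem_ERFM_arm.1 hα
      obtain ⟨hσ, hw⟩ := he
      refine ⟨?_, ?_⟩
      · rw [hb.crossReal_apply_U (hb.touches_U_of_within' hw), if_pos hj]
        exact hσ
      · obtain ⟨x, hx, y, hy, hxy⟩ := hw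
        have hmem : ∀ z ∈ U j ∪ {h, u}, z ∈ redSetX h u U p G F q := by
          intro z hz
          rcases hz with hz | hz
          · exact (mem_redSetX_U hb hz).2 hj
          · simp only [Set.mem_insert_iff, Set.mem_singleton_iff] at hz
            rcases hz with rfl | rfl
            · rw [mem_redSetX_iff]; exact Or.inl rfl
            · exact (mem_redSetX_u hb).2 ⟨j, hj⟩
        exact ⟨x, hmem x hx, y, hmem y hy, hxy⟩
    · -- `u`: no edges of its own
      exact ((Set.mem_empty_iff_false e).1 he).elim
    · -- a red u–`p i` edge
      obtain ⟨hs, huP⟩ := mem_ERFM_inl.1 hα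
      have huP' : q.2.2.1 i = true := huP
      have hup' : ends e = s(u, p i) := he
      refine ⟨?_, u, (mem_redSetX_u hb).2 hs, p i, (mem_redSetX_p hb).2 ⟨hs, attE_of_uP G huP'⟩,
        hup'⟩
      rw [hb.crossReal_apply_UP he, if_pos huP']
      exact hb.u_red e (p i) hup'
    · -- a red cross edge at an attached end
      obtain ⟨hs, hct⟩ := mem_ERFM_inl.1 hα
      simp only [redKEE, decide_eq_true_eq] at hct
      obtain ⟨hc, i₀, hi₀, hatt₀⟩ := hct
      obtain ⟨a, b, hab, he'⟩ := he
      have hadj : G.Adj a b := hb.adj_of_cross he'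
      -- both ends are attached: the end `i₀` is `a` or `b`, and the red edge carries the other
      have hsame : (⟨s(a, b), G.mem_edgeSet.2 hadj⟩ : G.edgeSet) = t := Subtype.ext hab.symm
      have hc' : q.2.2.2.1 ⟨s(a, b), G.mem_edgeSet.2 hadj⟩ = true := by rw [hsame]; exact hc
      have hatta : attE G q.2.2 a ∧ attE G q.2.2 b := by
        rw [hab] at hi₀
        rcases Sym2.mem_iff.1 hi₀ with rfl | rfl
        · refine ⟨hatt₀, ?_⟩
          have hc'' : q.2.2.2.1 ⟨s(b, i₀), G.mem_edgeSet.2 hadj.symm⟩ = true := by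
            have : (⟨s(b, i₀), G.mem_edgeSet.2 hadj.symm⟩ : G.edgeSet) =
                ⟨s(i₀, b), G.mem_edgeSet.2 hadj⟩ := Subtype.ext Sym2.eq_swap
            rw [this]; exact hc'
          exact attE_of_adj G hadj.symm hc'' hatt₀
        · exact ⟨attE_of_adj G hadj hc' hatt₀, hatt₀⟩
      refine ⟨?_, p a, (mem_redSetX_p hb).2 ⟨hs, hatta.1⟩, p b, (mem_redSetX_p hb).2 ⟨hs, hatta.2⟩,
        he'⟩
      rw [hb.crossReal_apply_C (show e ∈ clsCX ends p G t from ⟨a, b, hab, he'⟩), if_pos hc]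
      exact hb.cross_red a b e he'
    · -- a red far arm
      have hk : q.1 k = true := mem_ERFM_far.1 hα
      obtain ⟨hσ, hw⟩ := he
      refine ⟨?_, ?_⟩
      · rw [hb.crossReal_apply_F (hb.touches_F_of_within hw), if_pos hk]
        exact hσ
      · obtain ⟨x, hx, y, hy, hxy⟩ := hw
        have hmem : ∀ z ∈ F k ∪ {h}, z ∈ redSetX h u U p G F q := by
          intro z hz
          rcases hz with hz | hz
          · exact (mem_redSetX_F hb hz).2 hk
          · rw [Set.mem_singleton_iff] at hz
            rw [hz, mem_redSetX_iff]; exact Or.inl rfl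
        exact ⟨x, hmem x hx, y, hmem y hy, hxy⟩

end RedEdges

end CrossArm

end Summit.Ventures.PercRepro2
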